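import Literature.NumberTheory.EllipticCurves.SemistableModPImageProofs
import Literature.NumberTheory.EllipticCurves.QuadraticTwistFramedTorsion
import Literature.NumberTheory.EllipticCurves.GlobalMinimalModel
import Literature.NumberTheory.EllipticCurves.Tamagawa
import Literature.NumberTheory.EllipticCurves.SzpiroFreyProofs
import Literature.NumberTheory.Automorphic.LangWave0
import Literature.NumberTheory.Automorphic.CDTTheorem722
import Literature.NumberTheory.DiophantineGeometry.GeneralizedFermatTwoPowerCoefficientFreyProofs
import HarnessLib

/-!
# Stub-ideation k = 3, GEN 2 (home family 3: PROBE THE EXTREMES) for `stub_liftFive`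
# of crux `FreyModularity` (stmt-ABC-11340), line `Sketch`

Helper-lemma SIGNATURES (`sorry` bodies: G1core, G1a, G1b, G1c, G2, L2, L3, L4, H5, T1)
and KERNEL-CHECKED glue:

* `sigFrey_of_sig`, `sigFreySemistable_of_sig` — the reshaped stubs `SigFrey` (E1) and
  `SigFreySemistable` (E2) are WEAKER than the registered `stub_liftFive` (`Sig`), granted L2;
  `sigFrey_of_CDT722` — the tree's conditional closer still closes them;
* `isModular_freyCurve_of_sigFreySemistable` / `forall_isModular_freyCurve_of_sigFreySemistable`
  (plan α, NORMALISE FIRST): every Frey curve is modular from E2 + L4n (proved) + G1n + T1;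
* `hasMultiplicativeReductionAt_five_freyCurve_of_caseB` (G1 from G1core),
  `surjective_of_isSemistable_of_hasIrreducibleModPGaloisRep` (L1, proved),
  `surjective_five_freyCurve_of_caseB_normalised` (L4 on the normalised presentation, proved);
* `isModular_freyCurve_of_sigFrey` / `forall_isModular_freyCurve_of_sigFrey` — the composition of
  the line RE-GLUED through E1: every Frey curve is modular (the right-hand side, verbatim, of the
  landed `freyModularity_iff_forall_isModular_freyCurve`, whose `.mpr` is the crux `FreyModularity`
  by name — as in the skeleton's `FreyModularity_of`) from the reshaped stub, the other registered
  stubs, and the instance lemmas G1, G2, L4 (all provable now).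

Imports are Literature-only on purpose (the farm was rebuilding the summit-side `DefiniteXi…`
modules when this was checked); landed summit-side facts enter as hypotheses named in the docstrings.

The extreme probed: the route consumes `stub_liftFive` ONLY at Frey curves in case B at `3`, and there
(G1) `5 ∣ abc`, so `E` is MULTIPLICATIVE at `5` (ordinary, Tate curve) — never good, never flat —
and (L4) `ρ̄_{E,5}` is ONTO `GL₂(𝔽₅)`.
-/

set_option linter.dupNamespace false

noncomputable section

open scoped MatrixGroups NumberField

open Matrix Field IsDedekindDomain
open Literature.NumberTheory.EllipticCurves
open Literature.NumberTheory.Automorphic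
open Literature.NumberTheory.Automorphic.BCDT
open Literature.NumberTheory.GaloisRepresentations
open Literature.NumberTheory.DiophantineGeometry
open WeierstrassCurve

namespace Summit.ABC.ABC.Cruxes.FreyModularity.StubIdeas.LiftFive3

/-- The registered stub `stub_liftFive`, verbatim (Diamond 1996 Thm. 5.3 at `ℓ = 5`, Galois form). -/
def Sig : Prop :=
  ∀ (W : WeierstrassCurve ℚ) [W.IsElliptic] (ρ : ModPGaloisRep ℚ (ZMod 5) 2),
    W.IsTorsionGaloisRep 5 ρ → ρ.IsAbsIrreducibleOverSqrt 5 → ¬ 25 ∣ W.conductorNorm ℤ →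
    ρ.IsModular → W.IsModularGaloisRepTate 5

/-- Case B at `3` for a curve `W/ℚ`: no framed model of `W[3]` is absolutely irreducible over
`ℚ(√-3)` (the hypothesis shape of S12/S14/S15/S17 and of the case-B branch of the composition). -/
def CaseB (W : WeierstrassCurve ℚ) : Prop :=
  ∀ ρ₃ : ModPGaloisRep ℚ (ZMod 3) 2, W.IsTorsionGaloisRep 3 ρ₃ → ¬ ρ₃.IsAbsIrreducibleOverSqrt (-3)

/-! ## E — the reshaped stub: the minimal generality the route consumes -/

/-- **E1 `SigFrey` — modularity lifting at `5` in the LARGE-IMAGE, MULTIPLICATIVE-AT-5 extreme.**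
For `E/ℚ` with a framed model `ρ̄` of `E[5]` that is ONTO `GL₂(𝔽₅)`, `E` multiplicative at `5`
(so `ρ_{E,5}|G₅` ordinary, Tate curve), `E` semistable at every odd place, and `ρ̄` modular,
`ρ_{E,5}` is modular.  Engine in print: Wiles 1995 Thm. 0.2 case (i) ("`ρ₀` ordinary") at `p = 5`
+ Taylor–Wiles 1995 — hypothesis (i) of Thm. 0.2 by L2, hypothesis (ii) VACUOUS (the only possibly
additive prime is `2 ≢ -1 (mod 5)`; at multiplicative `q`, `ρ̄|D_q` is reducible).  No flat /
Fontaine–Laffaille deformation theory, no Diamond 1996 (`q ≠ ℓ` local analysis), no CDT 7.1.1. -/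
def SigFrey : Prop :=
  ∀ (W : WeierstrassCurve ℚ) [W.IsElliptic] (ρ : ModPGaloisRep ℚ (ZMod 5) 2),
    W.IsTorsionGaloisRep 5 ρ → Function.Surjective ρ →
    (∀ v : HeightOneSpectrum ℤ, Rat.HeightOneSpectrum.natGenerator v = 5 →
        W.HasMultiplicativeReductionAt v) →
    (∀ v : HeightOneSpectrum ℤ, Rat.HeightOneSpectrum.natGenerator v ≠ 2 → W.IsSemistableAt v) →
    ¬ 25 ∣ W.conductorNorm ℤ → ρ.IsModular → W.IsModularGaloisRepTate 5

/-- **E2 `SigFreySemistable` — the same, for SEMISTABLE curves only** (the normalised case-B Frey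
curves `E_(A,B)`, `A ≡ -1 (4)`, `16 ∣ B`, are semistable with `30 ∣ N`): modularity lifting at `5`
for `E/ℚ` semistable, multiplicative at `5`, `ρ̄_{E,5}` onto `GL₂(𝔽₅)` and modular.  Engine in
print: Taylor–Wiles 1995 + Wiles 1995 Thm. 0.2 case (i) for SEMISTABLE `ρ̄` = DDT 1995 Thm. 3.42
(hypotheses §3.3 (a)–(e): irreducible, modular, `det = ε`, `ρ̄|G_ℓ` semistable, `#ρ̄(I_p) ∣ ℓ` for
`p ≠ ℓ`) in its multiplicative-at-`ℓ` sub-case — the residually-semistable R = T theorem with NO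
flat deformation theory and NO `p ≠ ℓ` type analysis (Diamond 1996) at all; the additive prime `2`
of a general Frey curve is moved OUT of the R = T theorem into newform twisting (T1).  Weaker than
E1, hence than the registered stub. -/
def SigFreySemistable : Prop :=
  ∀ (W : WeierstrassCurve ℚ) [W.IsElliptic] (ρ : ModPGaloisRep ℚ (ZMod 5) 2),
    W.IsTorsionGaloisRep 5 ρ → Function.Surjective ρ → W.IsSemistable ℤ →
    (∀ v : HeightOneSpectrum ℤ, Rat.HeightOneSpectrum.natGenerator v = 5 →
        W.HasMultiplicativeReductionAt v) →
    ¬ 25 ∣ W.conductorNorm ℤ → ρ.IsModular → W.IsModularGaloisRepTate 5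

/-! ## L — the image extreme: `ρ̄_{E,5}` is onto `GL₂(𝔽₅)` in the consumed instance -/

/-- (Verbatim copy of `Summit.ABC.ABC.Theorems.surjective_of_hasSurjectiveModNGaloisRep`, S14 file
`DefiniteXiFreyModularityStubFreyCaseBThreeReducible` — copied only to keep this scratch file's
import closure Literature-only while the farm rebuilds the summit-side modules.)  If
`Γ_F → Aut(E[p])` is onto, every framed model of `E[p]` is onto `GL₂(𝔽_p)`. [folklore] -/
theorem surjective_of_hasSurjectiveModNGaloisRep' {F : Type} [Field F] {W : WeierstrassCurve F}
    {p : ℕ} [Fact p.Prime] (hs : W.HasSurjectiveModNGaloisRep (p : ℤ)) {ρ : ModPGaloisRep F (ZMod p) 2}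
    (hρ : W.IsTorsionGaloisRep p ρ) : Function.Surjective ρ := by
  obtain ⟨e, he⟩ := hρ
  intro M
  let f : (Fin 2 → ZMod p) ≃+ (Fin 2 → ZMod p) :=
    { toFun := fun v ↦ (M : Matrix (Fin 2) (Fin 2) (ZMod p)) *ᵥ v
      invFun := fun v ↦ ((M⁻¹ : GL (Fin 2) (ZMod p)) : Matrix (Fin 2) (Fin 2) (ZMod p)) *ᵥ v
      left_inv := fun v ↦ by
        simp only [Matrix.mulVec_mulVec, Units.inv_mul, Matrix.one_mulVec]
      right_inv := fun v ↦ by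
        simp only [Matrix.mulVec_mulVec, Units.mul_inv, Matrix.one_mulVec]
      map_add' := fun v w ↦ Matrix.mulVec_add _ _ _ }
  have hf : ∀ v, f v = (M : Matrix (Fin 2) (Fin 2) (ZMod p)) *ᵥ v := fun _ ↦ rfl
  obtain ⟨σ, hσ⟩ := hs (Multiplicative.ofAdd (e.trans (f.trans e.symm)))
  have hσP : ∀ P : geomTorsion W p, σ • P = e.symm (f (e P)) := fun P ↦ by
    have h := W.galoisRepTorsion_apply (p : ℤ) σ P
    rw [hσ, toAdd_ofAdd] at h
    exact h.symm
  refine ⟨σ, ?_⟩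
  have hv : ∀ v : Fin 2 → ZMod p,
      ((ρ σ : GL (Fin 2) (ZMod p)) : Matrix (Fin 2) (Fin 2) (ZMod p)) *ᵥ v =
        (M : Matrix (Fin 2) (Fin 2) (ZMod p)) *ᵥ v := fun v ↦ by
    have h := he σ (e.symm v)
    rw [hσP, AddEquiv.apply_symm_apply, AddEquiv.apply_symm_apply, hf] at h
    exact h.symm
  have hmat : ((ρ σ : GL (Fin 2) (ZMod p)) : Matrix (Fin 2) (Fin 2) (ZMod p)) =
      (M : Matrix (Fin 2) (Fin 2) (ZMod p)) :=
    Matrix.toLin'.injective (LinearMap.ext fun v ↦ by rw [Matrix.toLin'_apply, Matrix.toLin'_apply, hv])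
  exact Units.ext hmat

/-- **L1 (proved): semistable + `E[p]` irreducible ⇒ every framed model of `E[p]` is onto
`GL₂(𝔽_p)`** (Serre 1972 Prop. 21 / Edixhoven 1997 Prop. 2.1, a THEOREM of the tree:
`Edixhoven1997_prop_2_1_holds`, + `surjective_of_hasSurjectiveModNGaloisRep`).
[cite: Edixhoven1997, Prop. 2.1 (PDF p. 285)] -/
theorem surjective_of_isSemistable_of_hasIrreducibleModPGaloisRep (W : WeierstrassCurve ℚ)
    [W.IsElliptic] (hW : W.IsSemistable ℤ) {p : ℕ} [Fact p.Prime]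
    (hirr : W.HasIrreducibleModPGaloisRep p) {ρ : ModPGaloisRep ℚ (ZMod p) 2}
    (hρ : W.IsTorsionGaloisRep p ρ) : Function.Surjective ρ :=
  surjective_of_hasSurjectiveModNGaloisRep'
    (hasSurjectiveModNGaloisRep_of_hasIrreducibleModPGaloisRep Edixhoven1997_prop_2_1_holds W hW
      Fact.out hirr) hρ

/-- **L2 (S): a surjective `ρ̄ : Γ_ℚ → GL₂(𝔽₅)` is absolutely irreducible on `Γ_{ℚ(√5)}`** (indeed
on `Γ_L` for every quadratic `L`): `ρ̄(Γ_L)` contains the squares of `GL₂(𝔽₅)`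
(`sq_mem_range_absGaloisRestrict_of_isSplittingField`), in particular the unipotents
`(1 1; 0 1) = (1 3; 0 1)²`, `(1 0; 1 1) = (1 0; 3 1)²`, which have no common eigenvector over any
`B ⊇ 𝔽₅`.  Port of `isAbsIrreducibleOverSqrt_neg_three_of_surjective` (BCDTTheoremB) with `3 ↦ 5`. -/
theorem isAbsIrreducibleOverSqrt_five_of_surjective (ρ : ModPGaloisRep ℚ (ZMod 5) 2)
    (hsurj : Function.Surjective ρ) : ρ.IsAbsIrreducibleOverSqrt 5 := by
  sorry

/-- **L3 (S): surjectivity survives a quadratic twist.**  If `ρ̄ : Γ_ℚ → GL₂(𝔽₅)` is onto and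
`χ` is `{±1}`-valued then `ρ̄ ⊗ χ` is onto: its image contains the commutators of `im ρ̄`, i.e.
`SL₂(𝔽₅)` (H5), and `det (ρ̄ ⊗ χ) = χ² det ρ̄ = det ρ̄` is onto `𝔽₅ˣ`. -/
theorem surjective_twist_of_surjective (ρ : ModPGaloisRep ℚ (ZMod 5) 2)
    (χ : Field.absoluteGaloisGroup ℚ →ₜ* (ZMod 5)ˣ) (hχ : ∀ σ, χ σ = 1 ∨ χ σ = -1)
    (hsurj : Function.Surjective ρ) : Function.Surjective (FramedRep.twist ρ χ) := by
  sorry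

/-- **L4n (proved): on the NORMALISED presentation (`A ≡ -1 (mod 4)`, `2 ∣ B`) a case-B Frey curve
has `ρ̄_{E,5}` onto `GL₂(𝔽₅)`**: S12 (`hS12` = the landed `stub_freyCaseBSixteen`: `16 ∣ B`) makes
it semistable (`isSemistable_freyCurve_of_sixteen_dvd`), `E[5]` is irreducible for every Frey curve
(`hirr5` = the landed `Summit.ABC.ABC.Theorems.hasIrreducibleModPGaloisRep_freyCurve_five`,
reshape 3) — both passed as hypotheses only to keep this scratch file's import closure
Literature-only while the farm rebuilds the summit-side modules — and L1. -/
theorem surjective_five_freyCurve_of_caseB_normalised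
    (hS12 : ∀ (A B : ℤ) [(freyCurve A B).IsElliptic], IsCoprime A B → A * B * (A + B) ≠ 0 →
      A ≡ -1 [ZMOD 4] → (2 : ℤ) ∣ B →
      (∀ ρ₃ : ModPGaloisRep ℚ (ZMod 3) 2, (freyCurve A B).IsTorsionGaloisRep 3 ρ₃ →
        ¬ ρ₃.IsAbsIrreducibleOverSqrt (-3)) → (16 : ℤ) ∣ B)
    (hirr5 : ∀ a b : ℤ, IsCoprime a b → a * b * (a + b) ≠ 0 →
      (freyCurve a b).HasIrreducibleModPGaloisRep 5)
    {A B : ℤ} (hAB : IsCoprime A B)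
    (h0 : A * B * (A + B) ≠ 0) (hA : A ≡ -1 [ZMOD 4]) (h2 : (2 : ℤ) ∣ B)
    (hB : CaseB (freyCurve A B)) {ρ : ModPGaloisRep ℚ (ZMod 5) 2}
    (hρ : (freyCurve A B).IsTorsionGaloisRep 5 ρ) : Function.Surjective ρ := by
  haveI := isElliptic_freyCurve h0
  have h16 : (16 : ℤ) ∣ B := hS12 A B hAB h0 hA h2 hB
  exact surjective_of_isSemistable_of_hasIrreducibleModPGaloisRep (freyCurve A B)
    (isSemistable_freyCurve_of_sixteen_dvd hAB h0 hA h16) (hirr5 A B hAB h0) hρ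

/-- **L4 (M): in case B, EVERY framed model of `E_(a,b)[5]` is onto `GL₂(𝔽₅)`, for every Frey
curve** (no normalisation): normalise carrying case B (`exists_normalised_freyCurve_caseB`:
translations = `ℚ`-isomorphisms, `isTorsionGaloisRep_smul_iff`; the swap `E_(b,a) = E_(a,b)^{(-1)}`,
`exists_quadraticCharacter_isTorsionGaloisRep_quadraticTwist_iff` + L3), then L4n. -/
theorem surjective_five_freyCurve_of_caseB :
    ∀ (a b : ℤ) [(freyCurve a b).IsElliptic], IsCoprime a b → a * b * (a + b) ≠ 0 →
      CaseB (freyCurve a b) → ∀ ρ : ModPGaloisRep ℚ (ZMod 5) 2,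
        (freyCurve a b).IsTorsionGaloisRep 5 ρ → Function.Surjective ρ := by
  sorry

/-- **H5 (S; the TW supply in the large-image extreme): `[GL₂(𝔽₅), GL₂(𝔽₅)] = SL₂(𝔽₅)`.**  Hence
for `ρ̄` onto with `det ρ̄ = χ̄₅`: `ρ̄(Γ_{ℚ(ζ_{5ⁿ})}) = SL₂(𝔽₅)` for every `n ≥ 1` (a normal subgroup
with cyclic quotient contains the commutator; it lies in `ker det`), which is absolutely irreducible
and contains `diag(2, 3)` — Taylor–Wiles primes `q ≡ 1 (5ⁿ)` with distinct `ρ̄(Frob_q)`-eigenvalues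
exist by Čebotarev with NO image casework (DDT Thm. 2.49; replaces gen-1 H3 and the
`ℚ(√5) ⇒ ℚ(ζ₅)` upgrade k1-B1 / k2-H-A1 in this instance). -/
theorem commutator_GL_two_zmod_five_eq_ker_det :
    commutator (GL (Fin 2) (ZMod 5)) =
      (Matrix.GeneralLinearGroup.det : GL (Fin 2) (ZMod 5) →* (ZMod 5)ˣ).ker := by
  sorry

/-! ## G — the local extreme at `5`: case B forces `5 ∣ abc`, i.e. MULTIPLICATIVE reduction at `5` -/

/-- **G1a (S): `a₅ = ±2` on the integral Frey model when `5 ∤ abc`.**  The reduction of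
`y² = x(x-a)(x+b)` mod `5` is an elliptic curve with full rational `2`-torsion, so `4 ∣ #Ẽ(𝔽₅)`,
and `2 ≤ #Ẽ(𝔽₅) ≤ 10` (Hasse): `#Ẽ(𝔽₅) ∈ {4, 8}`.  Finite check over the `12` classes
`(a, b) mod 5` with `ab(a+b) ≢ 0` (pattern `frobeniusTrace_freyIntModel_three`, `reductionPointCount_E_seven`). -/
theorem frobeniusTrace_freyIntModel_five {a b : ℤ} (h5 : ¬ (5 : ℤ) ∣ a * b * (a + b)) :
    Literature.NumberTheory.Automorphic.frobeniusTrace (freyIntModel a b) 5 = 2 ∨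
      Literature.NumberTheory.Automorphic.frobeniusTrace (freyIntModel a b) 5 = -2 := by
  sorry

/-- **G1b (S/M−): the Eisenstein congruence `a_p ≡ ±(1 + p) (mod 3)` for a curve with
REDUCIBLE `E[3]`** (any Borel image — no semistability, no triviality of a constituent needed):
`ρ̄_{E,3} ~ (χ * ; 0 χ')` with `χχ' = ω` (`det_galoisRepTorsion_frobenius_eq`) and `χ² = 1`
(`𝔽₃ˣ = {±1}`), so `tr ρ̄(σ_p) = χ(σ_p)(1 + p)`; and `tr ρ̄(σ_p) ≡ a_p (mod 3)` for good `p ≠ 3`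
(`trace_galoisRepTorsion_frobenius_eq`, Serre (238)).  In particular `3 ∣ a_p` whenever
`p ≡ 2 (mod 3)` — used at `p = 5`.  The hypothesis is exactly the output of the landed S17
`stub_freyCaseBThreeReducibleAll` (transported to a global minimal model).
[cite: Serre1981, §8.1 eq. (238) (p. 188)] -/
theorem three_dvd_frobeniusTrace_sub_or_add_of_not_hasIrreducibleModPGaloisRep_three
    (W : WeierstrassCurve ℚ) [W.IsElliptic] [W.IsGloballyMinimal] {p : ℕ} [Fact p.Prime]
    (hp3 : p ≠ 3) (hgood : W.HasGoodReductionAtPrime p) (hred : ¬ W.HasIrreducibleModPGaloisRep 3) :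
    (3 : ℤ) ∣ W.frobeniusTrace p - (1 + p) ∨ (3 : ℤ) ∣ W.frobeniusTrace p + (1 + p) := by
  sorry

/-- **G1c (S): good reduction at `5` and `a₅` on a global minimal model of the Frey curve when
`5 ∤ abc`** (pattern `frobeniusTrace_three_smul_freyCurve`: `hasGoodReductionAt_map_of_not_dvd`,
`hasGoodReductionAt_smul_iff_holds`, `LFunction_apply_prime_eq_frobeniusTrace`, `LFunction_smul`,
`lFunction_map_apply_prime_of_not_dvd`). -/
theorem frobeniusTrace_five_smul_freyCurve {a b : ℤ} (h0 : a * b * (a + b) ≠ 0)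
    (h5 : ¬ (5 : ℤ) ∣ a * b * (a + b)) (C : VariableChange ℚ)
    [(C • freyCurve a b).IsGloballyMinimal] :
    (C • freyCurve a b).HasGoodReductionAtPrime 5 ∧
      (C • freyCurve a b).frobeniusTrace 5 =
        Literature.NumberTheory.Automorphic.frobeniusTrace (freyIntModel a b) 5 := by
  sorry

/-- **G1core (M−, assembly of G1a–c; S15 with `3 ↦ 5`): in case B, `5 ∣ ab(a+b)` — for EVERY
Frey curve, no normalisation.**  S17 (landed `stub_freyCaseBThreeReducibleAll`): case B ⇒ `E[3]`
reducible; reducibility is an isomorphism invariant, so it holds on a global minimal model `C • E`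
(`hasGlobalMinimalModel_rat_holds`); if `5 ∤ abc`, G1c makes `5` good for `C • E` with
`a₅ = a₅(freyIntModel) = ±2` (G1a), while G1b at `p = 5 ≡ 2 (mod 3)` gives `3 ∣ a₅`:
contradiction.  (Equivalently: `E` or `E/H` has torsion `⊇ ℤ/2 × ℤ/6`, which cannot inject into
`Ẽ(𝔽₅)`, `#Ẽ(𝔽₅) ≤ 10`.) [cite: Serre1972, §5.4 Prop. 21] [cite: SilvermanAEC2009, VII.3.1(b)] -/
theorem five_dvd_of_caseB {a b : ℤ} (hab : IsCoprime a b) (h0 : a * b * (a + b) ≠ 0)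
    (hB : CaseB (freyCurve a b)) : (5 : ℤ) ∣ a * b * (a + b) := by
  sorry

/-- **G1 (proved from G1core): in case B the Frey curve is MULTIPLICATIVE at the place `5`**
(`hasMultiplicativeReductionAt_freyCurve_of_ne_two`: at an odd `l ∣ abc` the integral Frey model is
minimal with `v_l(c₄) = 0 < v_l(Δ)`), i.e. `ρ_{E,5}|G₅` is ordinary (Tate curve) — the ONLY local
regime at `5` in which the route ever invokes `stub_liftFive`. [cite: Serre1987, §4.1 (4.1.2)] -/
theorem hasMultiplicativeReductionAt_five_freyCurve_of_caseB {a b : ℤ} (hab : IsCoprime a b)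
    (h0 : a * b * (a + b) ≠ 0) (hB : CaseB (freyCurve a b)) (v : HeightOneSpectrum ℤ)
    (hv : Rat.HeightOneSpectrum.natGenerator v = 5) :
    (freyCurve a b).HasMultiplicativeReductionAt v := by
  refine hasMultiplicativeReductionAt_freyCurve_of_ne_two hab h0 v (by rw [hv]; decide) ?_
  rw [hv]
  exact_mod_cast five_dvd_of_caseB hab h0 hB

/-- **G1n-core = G1core on the normalised presentation** (what plan α consumes; a special case). -/
theorem five_dvd_of_caseB_normalised {A B : ℤ} (hAB : IsCoprime A B) (h0 : A * B * (A + B) ≠ 0)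
    (_hA : A ≡ -1 [ZMOD 4]) (_h2 : (2 : ℤ) ∣ B) (hB : CaseB (freyCurve A B)) :
    (5 : ℤ) ∣ A * B * (A + B) :=
  five_dvd_of_caseB hAB h0 hB

/-- **G1n (proved from G1core): a normalised case-B Frey curve is multiplicative at `5`.** -/
theorem hasMultiplicativeReductionAt_five_freyCurve_of_caseB_normalised {A B : ℤ}
    (hAB : IsCoprime A B) (h0 : A * B * (A + B) ≠ 0) (hA : A ≡ -1 [ZMOD 4]) (h2 : (2 : ℤ) ∣ B)
    (hB : CaseB (freyCurve A B)) (v : HeightOneSpectrum ℤ)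
    (hv : Rat.HeightOneSpectrum.natGenerator v = 5) :
    (freyCurve A B).HasMultiplicativeReductionAt v := by
  refine hasMultiplicativeReductionAt_freyCurve_of_ne_two hAB h0 v (by rw [hv]; decide) ?_
  rw [hv]
  exact_mod_cast five_dvd_of_caseB_normalised hAB h0 hA h2 hB

/-- **T1 (M): normalisation carrying case B AND transporting modularity back** — the landed
`exists_normalised_freyCurve_caseB` (Diamond–Kramer 1995, Lemma 1: a translation, or the `−1`
twist `E_(b,a) = E_(a,b)^{(-1)}`, then a sign change) with one extra conjunct: modularity of the
normalised curve `E_(A,B)` (semistable, `2 ∥ N`) gives modularity of `E_(a,b)`.  Translations /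
sign changes are `ℚ`-isomorphisms (`L(C • W, s) = L(W, s)`, `LFunction_smul`); the `−1` twist is
newform twisting by `χ₋₄` (`IsModular.of_LFunction_eq_twist`, `exists_isNewform0_charTwist_packet`,
`LFunction_quadraticTwist_neg_one_apply_complex`; the tree's `IsModular.quadraticTwist_neg_one` is
the odd-`N` case — here `2 ∥ N` and `N(E^{(-1)}) = 8N`, Frey conductor at `2` from
`FreyCurveConductorTwoTwistDichotomyProofs`). [cite: DiamondKramer1995, Lemma 1]
[cite: AtkinLi1978, §3, Thm. 3.1] -/
theorem exists_normalised_freyCurve_caseB_isModular {a b : ℤ} (hab : IsCoprime a b)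
    (h0 : a * b * (a + b) ≠ 0) (hB : CaseB (freyCurve a b)) :
    ∃ A B : ℤ, IsCoprime A B ∧ A * B * (A + B) ≠ 0 ∧ A ≡ -1 [ZMOD 4] ∧ (2 : ℤ) ∣ B ∧
      CaseB (freyCurve A B) ∧
      ∀ [NeZero ((freyCurve A B).conductorNorm ℤ)] [NeZero ((freyCurve a b).conductorNorm ℤ)],
        BCDT.IsModular (freyCurve A B) → BCDT.IsModular (freyCurve a b) := by
  sorry

/-- **G2 (S): a Frey curve is semistable at every odd place** (`l ∣ abc`: multiplicative,
`hasMultiplicativeReductionAt_freyCurve_of_ne_two`; `l ∤ abc`: the integral model, minimal at `l`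
(`isMinimalAt_freyIntModel_of_ne_two`), has `l ∤ Δ = 16(abc)²` — `hasGoodReductionAt_iff_of_isMinimalAt`).
[cite: Serre1987, §4.1 (4.1.2)] -/
theorem isSemistableAt_freyCurve_of_ne_two {a b : ℤ} (hab : IsCoprime a b)
    (h0 : a * b * (a + b) ≠ 0) (v : HeightOneSpectrum ℤ)
    (hv : Rat.HeightOneSpectrum.natGenerator v ≠ 2) : (freyCurve a b).IsSemistableAt v := by
  sorry

/-! ## Glue (kernel-checked) -/

/-- **The reshaped stub is weaker than the registered one** (granted L2). -/
theorem sigFrey_of_sig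
    (hL2 : ∀ ρ : ModPGaloisRep ℚ (ZMod 5) 2, Function.Surjective ρ → ρ.IsAbsIrreducibleOverSqrt 5)
    (h : Sig) : SigFrey :=
  fun W _ ρ hρ hsurj _ _ h25 hmod ↦ h W ρ hρ (hL2 ρ hsurj) h25 hmod

/-- **The tree's conditional closer still closes the reshaped stub**: `CDT_theorem_7_2_2`
(`lift_of_CDT_theorem_7_2_2`), granted L2. -/
theorem sigFrey_of_CDT722
    (hL2 : ∀ ρ : ModPGaloisRep ℚ (ZMod 5) 2, Function.Surjective ρ → ρ.IsAbsIrreducibleOverSqrt 5)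
    (h722 : CDT_theorem_7_2_2) : SigFrey :=
  fun W _ ρ hρ hsurj _ _ _ hmod ↦ lift_of_CDT_theorem_7_2_2 h722 W ρ hρ (hL2 ρ hsurj) hmod

/-- E2 is weaker than E1 (a semistable curve is semistable at every odd place). -/
theorem sigFreySemistable_of_sigFrey (h : SigFrey) : SigFreySemistable :=
  fun W _ ρ hρ hsurj hS hmult h25 hmod ↦ h W ρ hρ hsurj hmult (fun v _ ↦ hS v) h25 hmod

/-- E2 is weaker than the registered stub (granted L2). -/
theorem sigFreySemistable_of_sig
    (hL2 : ∀ ρ : ModPGaloisRep ℚ (ZMod 5) 2, Function.Surjective ρ → ρ.IsAbsIrreducibleOverSqrt 5)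
    (h : Sig) : SigFreySemistable :=
  sigFreySemistable_of_sigFrey (sigFrey_of_sig hL2 h)

/-- **Plan α composition (kernel-checked): every Frey curve is modular from E2 (`SigFreySemistable`)**
— NORMALISE FIRST: in case B pass to the semistable representative `E₀ = E_(A,B)` (T1), run the
line's case-B argument on `E₀` (Frey rigidity at `5`, S4b, the `3`–`5` switch, S-nine, the lifting
at `3` — all stated for every curve / every Frey curve, so they apply to `E₀`), feed E2 with
`ρ̄_{E₀,5}` onto (L4n, PROVED), `E₀` semistable (S12 + `isSemistable_freyCurve_of_sixteen_dvd`),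
multiplicative at `5` (G1n), and transport modularity back to `E` (T1).  No L3/L4/G2 needed. -/
theorem isModular_freyCurve_of_sigFreySemistable
    (h1 : ∀ (W : WeierstrassCurve ℚ) [W.IsElliptic] [NeZero (W.conductorNorm ℤ)]
      (ρ : ModPGaloisRep ℚ (ZMod 3) 2), W.IsTorsionGaloisRep 3 ρ →
      ρ.IsAbsIrreducibleOverSqrt (-3) → ¬ 9 ∣ W.conductorNorm ℤ → BCDT.IsModular W)
    (hE : SigFreySemistable)
    (h32 : ∀ (W : WeierstrassCurve ℚ) [W.IsElliptic] [NeZero (W.conductorNorm ℤ)] (ℓ : ℕ)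
      [Fact ℓ.Prime], W.IsModularGaloisRepTate ℓ → BCDT.IsModular W)
    (h3 : ∀ (W : WeierstrassCurve ℚ) [W.IsElliptic], ¬ 27 ∣ W.conductorNorm ℤ →
      (∀ ρ₃ : ModPGaloisRep ℚ (ZMod 3) 2, W.IsTorsionGaloisRep 3 ρ₃ →
        ¬ ρ₃.IsAbsIrreducibleOverSqrt (-3)) →
      ∀ (ρ : ModPGaloisRep ℚ (ZMod 5) 2), W.IsTorsionGaloisRep 5 ρ → ρ.IsAbsIrreducibleOverSqrt 5 →
      ∃ (W' : WeierstrassCurve ℚ) (_ : W'.IsElliptic), W'.IsTorsionGaloisRep 5 ρ ∧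
        ∃ ρ₃' : ModPGaloisRep ℚ (ZMod 3) 2, W'.IsTorsionGaloisRep 3 ρ₃' ∧
          ρ₃'.IsAbsIrreducibleOverSqrt (-3))
    (h4a : ∀ a b : ℤ, IsCoprime a b → a * b * (a + b) ≠ 0 →
      ∀ ρ : ModPGaloisRep ℚ (ZMod 5) 2, (freyCurve a b).IsTorsionGaloisRep 5 ρ →
        FramedRep.IsIrreducible ρ)
    (h4b : ∀ (W : WeierstrassCurve ℚ) [W.IsElliptic], ¬ 25 ∣ W.conductorNorm ℤ →
      ∀ ρ : ModPGaloisRep ℚ (ZMod 5) 2, W.IsTorsionGaloisRep 5 ρ →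
        FramedRep.IsIrreducible ρ → ρ.IsAbsIrreducibleOverSqrt 5)
    (h6 : ∀ (W W' : WeierstrassCurve ℚ) [W.IsElliptic] [W'.IsElliptic]
      (ρ : ModPGaloisRep ℚ (ZMod 5) 2),
      W.IsTorsionGaloisRep 5 ρ → W'.IsTorsionGaloisRep 5 ρ →
      ¬ 9 ∣ W.conductorNorm ℤ → ¬ 9 ∣ W'.conductorNorm ℤ)
    (hN : ∀ a b : ℤ, IsCoprime a b → a * b * (a + b) ≠ 0 →
      ¬ 9 ∣ (freyCurve a b).conductorNorm ℤ ∧ ¬ 25 ∣ (freyCurve a b).conductorNorm ℤ)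
    (hS12 : ∀ (A B : ℤ) [(freyCurve A B).IsElliptic], IsCoprime A B → A * B * (A + B) ≠ 0 →
      A ≡ -1 [ZMOD 4] → (2 : ℤ) ∣ B →
      (∀ ρ₃ : ModPGaloisRep ℚ (ZMod 3) 2, (freyCurve A B).IsTorsionGaloisRep 3 ρ₃ →
        ¬ ρ₃.IsAbsIrreducibleOverSqrt (-3)) → (16 : ℤ) ∣ B)
    (hsurj : ∀ A B : ℤ, IsCoprime A B → A * B * (A + B) ≠ 0 → A ≡ -1 [ZMOD 4] → (2 : ℤ) ∣ B →
      CaseB (freyCurve A B) → ∀ ρ : ModPGaloisRep ℚ (ZMod 5) 2,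
        (freyCurve A B).IsTorsionGaloisRep 5 ρ → Function.Surjective ρ)
    (hG1n : ∀ A B : ℤ, IsCoprime A B → A * B * (A + B) ≠ 0 → A ≡ -1 [ZMOD 4] → (2 : ℤ) ∣ B →
      CaseB (freyCurve A B) → ∀ v : HeightOneSpectrum ℤ, Rat.HeightOneSpectrum.natGenerator v = 5 →
        (freyCurve A B).HasMultiplicativeReductionAt v)
    (hT1 : ∀ a b : ℤ, IsCoprime a b → a * b * (a + b) ≠ 0 → CaseB (freyCurve a b) →
      ∃ A B : ℤ, IsCoprime A B ∧ A * B * (A + B) ≠ 0 ∧ A ≡ -1 [ZMOD 4] ∧ (2 : ℤ) ∣ B ∧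
        CaseB (freyCurve A B) ∧
        ∀ [NeZero ((freyCurve A B).conductorNorm ℤ)] [NeZero ((freyCurve a b).conductorNorm ℤ)],
          BCDT.IsModular (freyCurve A B) → BCDT.IsModular (freyCurve a b))
    {a b : ℤ} (hab : IsCoprime a b) (h0 : a * b * (a + b) ≠ 0)
    [NeZero ((freyCurve a b).conductorNorm ℤ)] : BCDT.IsModular (freyCurve a b) := by
  haveI := isElliptic_freyCurve h0
  obtain ⟨h9, -⟩ := hN a b hab h0
  -- case A
  by_cases hA : ∃ ρ₃ : ModPGaloisRep ℚ (ZMod 3) 2,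
      (freyCurve a b).IsTorsionGaloisRep 3 ρ₃ ∧ ρ₃.IsAbsIrreducibleOverSqrt (-3)
  · obtain ⟨ρ₃, hρ₃, h3i⟩ := hA
    exact h1 (freyCurve a b) ρ₃ hρ₃ h3i h9
  -- case B: normalise first
  have hB : CaseB (freyCurve a b) := fun ρ₃ hρ₃ h3i ↦ hA ⟨ρ₃, hρ₃, h3i⟩
  obtain ⟨A, B, hAB, h0', hA4, h2B, hB', hback⟩ := hT1 a b hab h0 hB
  haveI := isElliptic_freyCurve h0'
  haveI : NeZero ((freyCurve A B).conductorNorm ℤ) := ⟨(conductorNorm_pos_holds _).ne'⟩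
  obtain ⟨h9', h25'⟩ := hN A B hAB h0'
  have h27' : ¬ 27 ∣ (freyCurve A B).conductorNorm ℤ := fun h27 ↦ h9' (dvd_trans ⟨3, rfl⟩ h27)
  obtain ⟨ρ, hρ⟩ := (freyCurve A B).exists_isTorsionGaloisRep 5
  have hirr : FramedRep.IsIrreducible ρ := h4a A B hAB h0' ρ hρ
  have h5 : ρ.IsAbsIrreducibleOverSqrt 5 := h4b (freyCurve A B) h25' ρ hρ hirr
  obtain ⟨W', hW', hρ', ρ₃', hρ₃', h3i'⟩ := h3 (freyCurve A B) h27' hB' ρ hρ h5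
  haveI := hW'
  haveI : NeZero (W'.conductorNorm ℤ) := ⟨(conductorNorm_pos_holds W').ne'⟩
  have h9W : ¬ 9 ∣ W'.conductorNorm ℤ := h6 (freyCurve A B) W' ρ hρ hρ' h9'
  have hE' : BCDT.IsModular W' := h1 W' ρ₃' hρ₃' h3i' h9W
  have hρmod : ρ.IsModular := hE'.isModular_of_isTorsionGaloisRep'' hρ'
  -- the extremes on the semistable representative
  have h16 : (16 : ℤ) ∣ B := hS12 A B hAB h0' hA4 h2B hB'
  have hS : (freyCurve A B).IsSemistable ℤ := isSemistable_freyCurve_of_sixteen_dvd hAB h0' hA4 h16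
  have h0mod : BCDT.IsModular (freyCurve A B) :=
    h32 (freyCurve A B) 5 (hE (freyCurve A B) ρ hρ (hsurj A B hAB h0' hA4 h2B hB' ρ hρ) hS
      (hG1n A B hAB h0' hA4 h2B hB') h25' hρmod)
  exact hback h0mod

/-- **Plan α with this file's typed lemmas plugged in**: the right-hand side, verbatim, of the landed
`freyModularity_iff_forall_isModular_freyCurve` (its `.mpr` is the crux by name) from E2 + the other
registered stubs + the landed S12 / Frey rigidity at `5`; remaining debts: E2's engine, G1n-core
(`five_dvd_of_caseB_normalised`), T1. -/
theorem forall_isModular_freyCurve_of_sigFreySemistable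
    (h1 : ∀ (W : WeierstrassCurve ℚ) [W.IsElliptic] [NeZero (W.conductorNorm ℤ)]
      (ρ : ModPGaloisRep ℚ (ZMod 3) 2), W.IsTorsionGaloisRep 3 ρ →
      ρ.IsAbsIrreducibleOverSqrt (-3) → ¬ 9 ∣ W.conductorNorm ℤ → BCDT.IsModular W)
    (hE : SigFreySemistable)
    (h32 : ∀ (W : WeierstrassCurve ℚ) [W.IsElliptic] [NeZero (W.conductorNorm ℤ)] (ℓ : ℕ)
      [Fact ℓ.Prime], W.IsModularGaloisRepTate ℓ → BCDT.IsModular W)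
    (h3 : ∀ (W : WeierstrassCurve ℚ) [W.IsElliptic], ¬ 27 ∣ W.conductorNorm ℤ →
      (∀ ρ₃ : ModPGaloisRep ℚ (ZMod 3) 2, W.IsTorsionGaloisRep 3 ρ₃ →
        ¬ ρ₃.IsAbsIrreducibleOverSqrt (-3)) →
      ∀ (ρ : ModPGaloisRep ℚ (ZMod 5) 2), W.IsTorsionGaloisRep 5 ρ → ρ.IsAbsIrreducibleOverSqrt 5 →
      ∃ (W' : WeierstrassCurve ℚ) (_ : W'.IsElliptic), W'.IsTorsionGaloisRep 5 ρ ∧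
        ∃ ρ₃' : ModPGaloisRep ℚ (ZMod 3) 2, W'.IsTorsionGaloisRep 3 ρ₃' ∧
          ρ₃'.IsAbsIrreducibleOverSqrt (-3))
    (h4a : ∀ a b : ℤ, IsCoprime a b → a * b * (a + b) ≠ 0 →
      ∀ ρ : ModPGaloisRep ℚ (ZMod 5) 2, (freyCurve a b).IsTorsionGaloisRep 5 ρ →
        FramedRep.IsIrreducible ρ)
    (hirr5 : ∀ a b : ℤ, IsCoprime a b → a * b * (a + b) ≠ 0 →
      (freyCurve a b).HasIrreducibleModPGaloisRep 5)
    (h4b : ∀ (W : WeierstrassCurve ℚ) [W.IsElliptic], ¬ 25 ∣ W.conductorNorm ℤ →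
      ∀ ρ : ModPGaloisRep ℚ (ZMod 5) 2, W.IsTorsionGaloisRep 5 ρ →
        FramedRep.IsIrreducible ρ → ρ.IsAbsIrreducibleOverSqrt 5)
    (h6 : ∀ (W W' : WeierstrassCurve ℚ) [W.IsElliptic] [W'.IsElliptic]
      (ρ : ModPGaloisRep ℚ (ZMod 5) 2),
      W.IsTorsionGaloisRep 5 ρ → W'.IsTorsionGaloisRep 5 ρ →
      ¬ 9 ∣ W.conductorNorm ℤ → ¬ 9 ∣ W'.conductorNorm ℤ)
    (hN : ∀ a b : ℤ, IsCoprime a b → a * b * (a + b) ≠ 0 →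
      ¬ 9 ∣ (freyCurve a b).conductorNorm ℤ ∧ ¬ 25 ∣ (freyCurve a b).conductorNorm ℤ)
    (hS12 : ∀ (A B : ℤ) [(freyCurve A B).IsElliptic], IsCoprime A B → A * B * (A + B) ≠ 0 →
      A ≡ -1 [ZMOD 4] → (2 : ℤ) ∣ B →
      (∀ ρ₃ : ModPGaloisRep ℚ (ZMod 3) 2, (freyCurve A B).IsTorsionGaloisRep 3 ρ₃ →
        ¬ ρ₃.IsAbsIrreducibleOverSqrt (-3)) → (16 : ℤ) ∣ B) :
    ∀ a b : ℤ, IsCoprime a b → a * b * (a + b) ≠ 0 →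
      ∀ [NeZero ((freyCurve a b).conductorNorm ℤ)], BCDT.IsModular (freyCurve a b) :=
  fun _ _ hab h0 _ ↦
    isModular_freyCurve_of_sigFreySemistable h1 hE h32 h3 h4a h4b h6 hN hS12
      (fun _ _ hAB h0 hA h2 hB _ hρ ↦
        surjective_five_freyCurve_of_caseB_normalised hS12 hirr5 hAB h0 hA h2 hB hρ)
      (fun _ _ hAB h0 hA h2 hB v hv ↦
        hasMultiplicativeReductionAt_five_freyCurve_of_caseB_normalised hAB h0 hA h2 hB v hv)
      (fun _ _ hab h0 hB ↦ exists_normalised_freyCurve_caseB_isModular hab h0 hB) hab h0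

/-- **Every Frey curve is modular, with the lifting input at `5` RESHAPED to `SigFrey`** — the case
analysis of CDT 1999, proof of Thm. 7.1.2 (p. 556) exactly as in the line's
`isModular_freyCurve_of_stubs`, except that in case B the lifting theorem at `5` is invoked in the
large-image multiplicative-at-`5` form, its extra hypotheses being discharged by the instance lemmas
G1 (`hG1`), G2 (`hG2`) and L4 (`hL4`). [cite: ConradDiamondTaylor1999, Thm. 7.1.2 (proof, p. 556)] -/
theorem isModular_freyCurve_of_sigFrey
    (h1 : ∀ (W : WeierstrassCurve ℚ) [W.IsElliptic] [NeZero (W.conductorNorm ℤ)]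
      (ρ : ModPGaloisRep ℚ (ZMod 3) 2), W.IsTorsionGaloisRep 3 ρ →
      ρ.IsAbsIrreducibleOverSqrt (-3) → ¬ 9 ∣ W.conductorNorm ℤ → BCDT.IsModular W)
    (hE : SigFrey)
    (h32 : ∀ (W : WeierstrassCurve ℚ) [W.IsElliptic] [NeZero (W.conductorNorm ℤ)] (ℓ : ℕ)
      [Fact ℓ.Prime], W.IsModularGaloisRepTate ℓ → BCDT.IsModular W)
    (h3 : ∀ (W : WeierstrassCurve ℚ) [W.IsElliptic], ¬ 27 ∣ W.conductorNorm ℤ →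
      (∀ ρ₃ : ModPGaloisRep ℚ (ZMod 3) 2, W.IsTorsionGaloisRep 3 ρ₃ →
        ¬ ρ₃.IsAbsIrreducibleOverSqrt (-3)) →
      ∀ (ρ : ModPGaloisRep ℚ (ZMod 5) 2), W.IsTorsionGaloisRep 5 ρ → ρ.IsAbsIrreducibleOverSqrt 5 →
      ∃ (W' : WeierstrassCurve ℚ) (_ : W'.IsElliptic), W'.IsTorsionGaloisRep 5 ρ ∧
        ∃ ρ₃' : ModPGaloisRep ℚ (ZMod 3) 2, W'.IsTorsionGaloisRep 3 ρ₃' ∧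
          ρ₃'.IsAbsIrreducibleOverSqrt (-3))
    (h4a : ∀ a b : ℤ, IsCoprime a b → a * b * (a + b) ≠ 0 →
      ∀ ρ : ModPGaloisRep ℚ (ZMod 5) 2, (freyCurve a b).IsTorsionGaloisRep 5 ρ →
        FramedRep.IsIrreducible ρ)
    (h4b : ∀ (W : WeierstrassCurve ℚ) [W.IsElliptic], ¬ 25 ∣ W.conductorNorm ℤ →
      ∀ ρ : ModPGaloisRep ℚ (ZMod 5) 2, W.IsTorsionGaloisRep 5 ρ →
        FramedRep.IsIrreducible ρ → ρ.IsAbsIrreducibleOverSqrt 5)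
    (h6 : ∀ (W W' : WeierstrassCurve ℚ) [W.IsElliptic] [W'.IsElliptic]
      (ρ : ModPGaloisRep ℚ (ZMod 5) 2),
      W.IsTorsionGaloisRep 5 ρ → W'.IsTorsionGaloisRep 5 ρ →
      ¬ 9 ∣ W.conductorNorm ℤ → ¬ 9 ∣ W'.conductorNorm ℤ)
    (hG1 : ∀ a b : ℤ, IsCoprime a b → a * b * (a + b) ≠ 0 → CaseB (freyCurve a b) →
      ∀ v : HeightOneSpectrum ℤ, Rat.HeightOneSpectrum.natGenerator v = 5 →
        (freyCurve a b).HasMultiplicativeReductionAt v)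
    (hG2 : ∀ a b : ℤ, IsCoprime a b → a * b * (a + b) ≠ 0 →
      ∀ v : HeightOneSpectrum ℤ, Rat.HeightOneSpectrum.natGenerator v ≠ 2 →
        (freyCurve a b).IsSemistableAt v)
    (hL4 : ∀ (a b : ℤ) [(freyCurve a b).IsElliptic], IsCoprime a b → a * b * (a + b) ≠ 0 →
      CaseB (freyCurve a b) → ∀ ρ : ModPGaloisRep ℚ (ZMod 5) 2,
        (freyCurve a b).IsTorsionGaloisRep 5 ρ → Function.Surjective ρ)
    (hN : ∀ a b : ℤ, IsCoprime a b → a * b * (a + b) ≠ 0 →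
      ¬ 9 ∣ (freyCurve a b).conductorNorm ℤ ∧ ¬ 25 ∣ (freyCurve a b).conductorNorm ℤ)
    {a b : ℤ} (hab : IsCoprime a b) (h0 : a * b * (a + b) ≠ 0)
    [NeZero ((freyCurve a b).conductorNorm ℤ)] : BCDT.IsModular (freyCurve a b) := by
  haveI := isElliptic_freyCurve h0
  obtain ⟨h9, h25⟩ := hN a b hab h0
  -- case A: some framed model of `E[3]` is absolutely irreducible over `ℚ(√-3)`
  by_cases hA : ∃ ρ₃ : ModPGaloisRep ℚ (ZMod 3) 2,
      (freyCurve a b).IsTorsionGaloisRep 3 ρ₃ ∧ ρ₃.IsAbsIrreducibleOverSqrt (-3)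
  · obtain ⟨ρ₃, hρ₃, h3i⟩ := hA
    exact h1 (freyCurve a b) ρ₃ hρ₃ h3i h9
  -- case B
  have hB : CaseB (freyCurve a b) := fun ρ₃ hρ₃ h3i ↦ hA ⟨ρ₃, hρ₃, h3i⟩
  have h27 : ¬ 27 ∣ (freyCurve a b).conductorNorm ℤ := fun h27 ↦ h9 (dvd_trans ⟨3, rfl⟩ h27)
  obtain ⟨ρ, hρ⟩ := (freyCurve a b).exists_isTorsionGaloisRep 5
  have hirr : FramedRep.IsIrreducible ρ := h4a a b hab h0 ρ hρ
  have h5 : ρ.IsAbsIrreducibleOverSqrt 5 := h4b (freyCurve a b) h25 ρ hρ hirr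
  -- the `3`–`5` switch from `E` itself
  obtain ⟨W', hW', hρ', ρ₃', hρ₃', h3i'⟩ := h3 (freyCurve a b) h27 hB ρ hρ h5
  haveI := hW'
  haveI : NeZero (W'.conductorNorm ℤ) := ⟨(conductorNorm_pos_holds W').ne'⟩
  have h9' : ¬ 9 ∣ W'.conductorNorm ℤ := h6 (freyCurve a b) W' ρ hρ hρ' h9
  have hE' : BCDT.IsModular W' := h1 W' ρ₃' hρ₃' h3i' h9'
  have hρmod : ρ.IsModular := hE'.isModular_of_isTorsionGaloisRep'' hρ'
  -- the extremes: in case B, `E` is multiplicative at `5`, semistable at odd places, and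
  -- `ρ̄ = ρ̄_{E,5}` is onto `GL₂(𝔽₅)`; so the RESHAPED lifting statement applies
  have hsurj : Function.Surjective ρ := hL4 a b hab h0 hB ρ hρ
  exact h32 (freyCurve a b) 5
    (hE (freyCurve a b) ρ hρ hsurj (hG1 a b hab h0 hB) (hG2 a b hab h0) h25 hρmod)

/-- **Every Frey curve is modular — the right-hand side of the landed
`Summit.ABC.ABC.Theorems.freyModularity_iff_forall_isModular_freyCurve`, VERBATIM — from the
reshaped stub**: the line's `FreyModularity_of` with `stub_liftFive` replaced by E1 (`SigFrey`) and
the instance lemmas G1, G2, L4; `.mpr` of that iff (exactly as in the skeleton's `FreyModularity_of`)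
turns this into the crux `Summit.ABC.ABC.Theses.DefiniteXi.FreyModularity` by name.  Inputs:
`h1` = `liftThree_of_stubs stub_modThree stub_liftThree stub_threeImpTwo`, `h32` = `stub_threeImpTwo`,
`h3` = `stub_switch`, `h4a` = `isIrreducible_freyCurve_five` (reshape 3, landed), `h4b` = the landed
`stub_absIrrSqrtFive`, `h6` = the landed `stub_nineTransfer`, `hN` =
`not_nine_dvd_conductorNorm_freyCurve` ∧ `not_twentyFive_dvd_conductorNorm_freyCurve` (landed) — the
landed ones passed as hypotheses only to keep this scratch file Literature-only while the farm
rebuilds the summit-side modules. [cite: ConradDiamondTaylor1999, Thm. 7.1.2 (proof, p. 556)] -/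
theorem forall_isModular_freyCurve_of_sigFrey
    (h1 : ∀ (W : WeierstrassCurve ℚ) [W.IsElliptic] [NeZero (W.conductorNorm ℤ)]
      (ρ : ModPGaloisRep ℚ (ZMod 3) 2), W.IsTorsionGaloisRep 3 ρ →
      ρ.IsAbsIrreducibleOverSqrt (-3) → ¬ 9 ∣ W.conductorNorm ℤ → BCDT.IsModular W)
    (hE : SigFrey)
    (h32 : ∀ (W : WeierstrassCurve ℚ) [W.IsElliptic] [NeZero (W.conductorNorm ℤ)] (ℓ : ℕ)
      [Fact ℓ.Prime], W.IsModularGaloisRepTate ℓ → BCDT.IsModular W)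
    (h3 : ∀ (W : WeierstrassCurve ℚ) [W.IsElliptic], ¬ 27 ∣ W.conductorNorm ℤ →
      (∀ ρ₃ : ModPGaloisRep ℚ (ZMod 3) 2, W.IsTorsionGaloisRep 3 ρ₃ →
        ¬ ρ₃.IsAbsIrreducibleOverSqrt (-3)) →
      ∀ (ρ : ModPGaloisRep ℚ (ZMod 5) 2), W.IsTorsionGaloisRep 5 ρ → ρ.IsAbsIrreducibleOverSqrt 5 →
      ∃ (W' : WeierstrassCurve ℚ) (_ : W'.IsElliptic), W'.IsTorsionGaloisRep 5 ρ ∧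
        ∃ ρ₃' : ModPGaloisRep ℚ (ZMod 3) 2, W'.IsTorsionGaloisRep 3 ρ₃' ∧
          ρ₃'.IsAbsIrreducibleOverSqrt (-3))
    (h4a : ∀ a b : ℤ, IsCoprime a b → a * b * (a + b) ≠ 0 →
      ∀ ρ : ModPGaloisRep ℚ (ZMod 5) 2, (freyCurve a b).IsTorsionGaloisRep 5 ρ →
        FramedRep.IsIrreducible ρ)
    (h4b : ∀ (W : WeierstrassCurve ℚ) [W.IsElliptic], ¬ 25 ∣ W.conductorNorm ℤ →
      ∀ ρ : ModPGaloisRep ℚ (ZMod 5) 2, W.IsTorsionGaloisRep 5 ρ →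
        FramedRep.IsIrreducible ρ → ρ.IsAbsIrreducibleOverSqrt 5)
    (h6 : ∀ (W W' : WeierstrassCurve ℚ) [W.IsElliptic] [W'.IsElliptic]
      (ρ : ModPGaloisRep ℚ (ZMod 5) 2),
      W.IsTorsionGaloisRep 5 ρ → W'.IsTorsionGaloisRep 5 ρ →
      ¬ 9 ∣ W.conductorNorm ℤ → ¬ 9 ∣ W'.conductorNorm ℤ)
    (hN : ∀ a b : ℤ, IsCoprime a b → a * b * (a + b) ≠ 0 →
      ¬ 9 ∣ (freyCurve a b).conductorNorm ℤ ∧ ¬ 25 ∣ (freyCurve a b).conductorNorm ℤ)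
    (hG1 : ∀ a b : ℤ, IsCoprime a b → a * b * (a + b) ≠ 0 → CaseB (freyCurve a b) →
      ∀ v : HeightOneSpectrum ℤ, Rat.HeightOneSpectrum.natGenerator v = 5 →
        (freyCurve a b).HasMultiplicativeReductionAt v)
    (hG2 : ∀ a b : ℤ, IsCoprime a b → a * b * (a + b) ≠ 0 →
      ∀ v : HeightOneSpectrum ℤ, Rat.HeightOneSpectrum.natGenerator v ≠ 2 →
        (freyCurve a b).IsSemistableAt v)
    (hL4 : ∀ (a b : ℤ) [(freyCurve a b).IsElliptic], IsCoprime a b → a * b * (a + b) ≠ 0 →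
      CaseB (freyCurve a b) → ∀ ρ : ModPGaloisRep ℚ (ZMod 5) 2,
        (freyCurve a b).IsTorsionGaloisRep 5 ρ → Function.Surjective ρ) :
    ∀ a b : ℤ, IsCoprime a b → a * b * (a + b) ≠ 0 →
      ∀ [NeZero ((freyCurve a b).conductorNorm ℤ)], BCDT.IsModular (freyCurve a b) :=
  fun _ _ hab h0 _ ↦
    isModular_freyCurve_of_sigFrey h1 hE h32 h3 h4a h4b h6 hG1 hG2 hL4 hN hab h0

/-- **With this file's typed instance lemmas plugged in** (G1 via `five_dvd_of_caseB`, G2, L4 — their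
`sorry`s and E1's engine are then the only debts of the case-B branch at `5`). -/
theorem forall_isModular_freyCurve_of_sigFrey'
    (h1 : ∀ (W : WeierstrassCurve ℚ) [W.IsElliptic] [NeZero (W.conductorNorm ℤ)]
      (ρ : ModPGaloisRep ℚ (ZMod 3) 2), W.IsTorsionGaloisRep 3 ρ →
      ρ.IsAbsIrreducibleOverSqrt (-3) → ¬ 9 ∣ W.conductorNorm ℤ → BCDT.IsModular W)
    (hE : SigFrey)
    (h32 : ∀ (W : WeierstrassCurve ℚ) [W.IsElliptic] [NeZero (W.conductorNorm ℤ)] (ℓ : ℕ)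
      [Fact ℓ.Prime], W.IsModularGaloisRepTate ℓ → BCDT.IsModular W)
    (h3 : ∀ (W : WeierstrassCurve ℚ) [W.IsElliptic], ¬ 27 ∣ W.conductorNorm ℤ →
      (∀ ρ₃ : ModPGaloisRep ℚ (ZMod 3) 2, W.IsTorsionGaloisRep 3 ρ₃ →
        ¬ ρ₃.IsAbsIrreducibleOverSqrt (-3)) →
      ∀ (ρ : ModPGaloisRep ℚ (ZMod 5) 2), W.IsTorsionGaloisRep 5 ρ → ρ.IsAbsIrreducibleOverSqrt 5 →
      ∃ (W' : WeierstrassCurve ℚ) (_ : W'.IsElliptic), W'.IsTorsionGaloisRep 5 ρ ∧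
        ∃ ρ₃' : ModPGaloisRep ℚ (ZMod 3) 2, W'.IsTorsionGaloisRep 3 ρ₃' ∧
          ρ₃'.IsAbsIrreducibleOverSqrt (-3))
    (h4a : ∀ a b : ℤ, IsCoprime a b → a * b * (a + b) ≠ 0 →
      ∀ ρ : ModPGaloisRep ℚ (ZMod 5) 2, (freyCurve a b).IsTorsionGaloisRep 5 ρ →
        FramedRep.IsIrreducible ρ)
    (h4b : ∀ (W : WeierstrassCurve ℚ) [W.IsElliptic], ¬ 25 ∣ W.conductorNorm ℤ →
      ∀ ρ : ModPGaloisRep ℚ (ZMod 5) 2, W.IsTorsionGaloisRep 5 ρ →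
        FramedRep.IsIrreducible ρ → ρ.IsAbsIrreducibleOverSqrt 5)
    (h6 : ∀ (W W' : WeierstrassCurve ℚ) [W.IsElliptic] [W'.IsElliptic]
      (ρ : ModPGaloisRep ℚ (ZMod 5) 2),
      W.IsTorsionGaloisRep 5 ρ → W'.IsTorsionGaloisRep 5 ρ →
      ¬ 9 ∣ W.conductorNorm ℤ → ¬ 9 ∣ W'.conductorNorm ℤ)
    (hN : ∀ a b : ℤ, IsCoprime a b → a * b * (a + b) ≠ 0 →
      ¬ 9 ∣ (freyCurve a b).conductorNorm ℤ ∧ ¬ 25 ∣ (freyCurve a b).conductorNorm ℤ) :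
    ∀ a b : ℤ, IsCoprime a b → a * b * (a + b) ≠ 0 →
      ∀ [NeZero ((freyCurve a b).conductorNorm ℤ)], BCDT.IsModular (freyCurve a b) :=
  forall_isModular_freyCurve_of_sigFrey h1 hE h32 h3 h4a h4b h6 hN
    (fun _ _ hab h0 hB v hv ↦ hasMultiplicativeReductionAt_five_freyCurve_of_caseB hab h0 hB v hv)
    (fun _ _ hab h0 v hv ↦ isSemistableAt_freyCurve_of_ne_two hab h0 v hv)
    (fun a b _ ↦ surjective_five_freyCurve_of_caseB a b)

end Summit.ABC.ABC.Cruxes.FreyModularity.StubIdeas.LiftFive3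

end
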